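import Summits.BirchSwinnertonDyer.Rank1Residual.X11a.PrintProductDisplay
import Summits.BirchSwinnertonDyer.BirchSwinnertonDyer.Theorems.PrintX11aLowerHalfSurjRoadP1
import HarnessLib

/-!
# Print route X11a, road p1 (seat p1, generation 3): the PRODUCT-DISPLAY socket reaches crux
# `X11aLowerHalf` (item stmt-BirchSwinnertonDyer-19064) on the surjective sub-leaf BY NAME, and the
# two earlier sockets of the road factor through it

HONEST FRAMING (cell bsd-print-x11a, HOME run/shared/lean/pub/bsd-print-x11a/, memo P1-ROAD.md §7).
Companion of `Summits/BirchSwinnertonDyer/Rank1Residual/X11a/PrintProductDisplay.lean` (the typed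
OPEN input `X11a.ProductDisplayAt W p`: a cyclotomic product display over `n ≥ 0` auxiliary
multiplicative factors, and `X11a.mazurMainConjectureAt_of_productDisplay`) and of this seat's
`Theorems/PrintX11aLowerHalfSurjRoadP1.lean` (by-name bridges of the sockets (S1)
`X11a.EisensteinHalfAt`, (S2) `X11a.BaseChangeLowerBoundAt`). Helper file `--supports
stmt-BirchSwinnertonDyer-19064`; it proves NO registered stub (K2's `stub_lowerSurj` asks the lower
half on the WHOLE surjective sub-leaf from nothing; here it is derived on `5 ≤ p ∧ Surj` from the
typed input) — theorems only, no `def`, no fact, no sorry. «beyond-print theorem: NO (glue); a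
closure on the socket: YES». Nothing booked; no label change; PARTITION 0.

CONTENT.
* `productDisplayAt_of_baseChangeLowerBoundAt` — (S2) is the case `n = 3` of the product display:
  at `p ≥ 5` multiplicative with `ρ̄_{E,p}` onto, the Burungale–Castella–Skinner four-factor display
  yields a product display whose auxiliary factors are globally minimal models of
  `E^{d_K}, E^{d_F}, E^{d_K d_F}` (multiplicative at `p` as `p ∤ d_K d_F`; `ρ̄` onto by twist
  invariance), granted modularity (`hpar`) to attach newforms and `ϖᵢ`; of (S2)'s field clauses only
  `d_K < 0`, `1 < d_F`, `(d_K d_F, pN) = 1` are used — the clauses a `p ‖ N` transplant of BCS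
  Lemma 5.2.3 would change (`p` inert vs split in `F`) are NOT.
* `x11aLowerHalf_onSurjFive_of_forall_productDisplayAt`,
  `x11aLowerHalf_onSurjFive_of_forall_leaf_productDisplayAt` (input asked only on `X11a.Leaf ∧ Surj`;
  unit cells by Wuthrich Prop. 21), `x11aLowerHalf_of_forall_leaf_productDisplayAt_of_three_of_nonSurj`
  (19064's body verbatim via `x11aLowerHalf_of_subleaves`) — the by-name bridges, same hypothesis
  lists as the (S1)/(S2) bridges of `PrintX11aLowerHalfSurjRoadP1.lean`.
* `forall_leaf_productDisplayAt_of_forall_leaf_eisensteinHalfAt` (`n = 0`),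
  `forall_leaf_productDisplayAt_of_forall_leaf_baseChangeLowerBoundAt` (`n = 3`): the (S1) and (S2)
  roads FACTOR through the product display, so from now on ONE socket carries road p1.

References: [BurungaleCastellaSkinner2025] Lemma 5.2.3, Prop. 5.2.1, display (5.3), "Proof of
Theorem 1.1.2" (arXiv:2405.00270v2 pp. 9–10); [Wuthrich2014] Prop. 21, Thm. 3, Cor. 19;
[SteinWuthrich2013] Thm. 6.1; [Miller2011LMS] Def. 1.1; route file `Theses/PrintX11a.lean` (item
19064); seat files p532019, p533431, p537674, p542857, p546689.
-/

set_option autoImplicit false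

noncomputable section

open scoped Classical MatrixGroups ModularForm

open CongruenceSubgroup WeierstrassCurve Literature.NumberTheory.EllipticCurves
  Literature.NumberTheory.EllipticCurves.ModularForms
  Literature.NumberTheory.EllipticCurves.Rank1Residual
  Literature.NumberTheory.EllipticCurves.Rank1Residual.Typed
  Literature.NumberTheory.EllipticCurves.Wuthrich2014
  Literature.NumberTheory.EllipticCurves.SteinWuthrich2013
  Summit.BirchSwinnertonDyer.Rank1Residual

namespace Summit.BirchSwinnertonDyer.BirchSwinnertonDyer.Theorems

/-! ### (S2) ⟹ product display (`n = 3`) -/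

/-- **(S2) is the case `n = 3`**: the Burungale–Castella–Skinner four-factor display
`BaseChangeLowerBoundAt W p` gives the product display at `p ≥ 5` multiplicative with `ρ̄_{E,p}`
onto, granted modularity as `nonempty_modularParametrizationData` (`hpar`, used only to attach
newforms and period ratios `ϖᵢ` to the three twists): the auxiliary factors are globally minimal
models of `E^{d_K}, E^{d_F}, E^{d_K d_F}` (multiplicative at `p` since `p ∤ d_K d_F`; `ρ̄` onto by
twist invariance) with their newforms, Selmer data and THE `p`-adic `L`-functions; of the field
conditions of (S2) only `d_K ≠ 0`, `d_F ≠ 0`, `p ∤ d_K d_F` are used. So every bridge from (S2)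
FACTORS through this file's socket.
[cite: BurungaleCastellaSkinner2025, Lemma 5.2.3, Prop. 5.2.1 and display (5.3) (arXiv:2405.00270v2 pp. 9–10) (shape only)]
[cite: SerreAbelianLadic1968, Ch. IV §3.4] [cite: SilvermanAEC2009, VII.5 Prop. 5.1(b), X.5 Cor. 5.4] -/
theorem productDisplayAt_of_baseChangeLowerBoundAt
    (W : WeierstrassCurve ℚ) [W.IsElliptic] [W.IsGloballyMinimal] (p : ℕ) [Fact p.Prime]
    (hpar : nonempty_modularParametrizationData)
    (hp : 5 ≤ p) (hmult : W.HasMultiplicativeReductionAtPrime p) (hsurj : Surj W p)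
    (hBC : X11a.BaseChangeLowerBoundAt W p) : X11a.ProductDisplayAt W p := by
  intro κ γ hκ hγ hγ' N _ f hf D ϖ hϖ L hL
  have hpP : p.Prime := Fact.out
  have hp2 : p ≠ 2 := by omega
  have hpZ : Prime (p : ℤ) := Nat.prime_iff_prime_int.mp hpP
  obtain ⟨dK, dF, hK0, -, -, -, hF1, -, -, -, hcop, -, -, H⟩ := hBC κ γ hκ hγ hγ' f hf
  have hpunit : ¬ IsUnit (p : ℤ) := by
    rw [Int.isUnit_iff_natAbs_eq, Int.natAbs_natCast]
    exact hpP.one_lt.ne'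
  have hpK : ¬ (p : ℤ) ∣ dK := fun h =>
    hpunit (hcop.isUnit_of_dvd' (dvd_mul_of_dvd_left h _) (dvd_mul_right _ _))
  have hpF : ¬ (p : ℤ) ∣ dF := fun h =>
    hpunit (hcop.isUnit_of_dvd' (dvd_mul_of_dvd_right h _) (dvd_mul_right _ _))
  have hpKF : ¬ (p : ℤ) ∣ dK * dF := fun h => (hpZ.dvd_or_dvd h).elim hpK hpF
  have hF0 : dF ≠ 0 := by omega
  have hK0' : (dK : ℚ) ≠ 0 := by exact_mod_cast hK0.ne
  have hF0' : (dF : ℚ) ≠ 0 := by exact_mod_cast hF0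
  have hKF0' : ((dK * dF : ℤ) : ℚ) ≠ 0 := by exact_mod_cast mul_ne_zero hK0.ne hF0
  obtain ⟨W₁, hE₁, hM₁, C₁, hC₁⟩ := exists_isGloballyMinimal_smul_eq_quadraticTwist W hK0'
  obtain ⟨W₂, hE₂, hM₂, C₂, hC₂⟩ := exists_isGloballyMinimal_smul_eq_quadraticTwist W hF0'
  obtain ⟨W₃, hE₃, hM₃, C₃, hC₃⟩ := exists_isGloballyMinimal_smul_eq_quadraticTwist W hKF0'
  have hm₁ : W₁.HasMultiplicativeReductionAtPrime p :=
    X2.hasMultiplicativeReductionAtPrime_of_smul_eq_quadraticTwist W W₁ hC₁ p hp2 hpK hmult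
  have hm₂ : W₂.HasMultiplicativeReductionAtPrime p :=
    X2.hasMultiplicativeReductionAtPrime_of_smul_eq_quadraticTwist W W₂ hC₂ p hp2 hpF hmult
  have hm₃ : W₃.HasMultiplicativeReductionAtPrime p :=
    X2.hasMultiplicativeReductionAtPrime_of_smul_eq_quadraticTwist W W₃ hC₃ p hp2 hpKF hmult
  -- `ρ̄` onto for the twists (twist invariance)
  have hs₁ : Surj W₁ p :=
    (Additive.surj_iff_of_model_twist W p hK0' ⟨C₁⁻¹, by rw [← hC₁, inv_smul_smul]⟩).mpr hsurj
  have hs₂ : Surj W₂ p :=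
    (Additive.surj_iff_of_model_twist W p hF0' ⟨C₂⁻¹, by rw [← hC₂, inv_smul_smul]⟩).mpr hsurj
  have hs₃ : Surj W₃ p :=
    (Additive.surj_iff_of_model_twist W p hKF0' ⟨C₃⁻¹, by rw [← hC₃, inv_smul_smul]⟩).mpr hsurj
  haveI : NeZero (W₁.conductorNorm ℤ) := ⟨(W₁.conductorNorm_pos_holds).ne'⟩
  haveI : NeZero (W₂.conductorNorm ℤ) := ⟨(W₂.conductorNorm_pos_holds).ne'⟩
  haveI : NeZero (W₃.conductorNorm ℤ) := ⟨(W₃.conductorNorm_pos_holds).ne'⟩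
  obtain ⟨Dm₁⟩ := hpar W₁
  obtain ⟨Dm₂⟩ := hpar W₂
  obtain ⟨Dm₃⟩ := hpar W₃
  obtain ⟨ϖ₁, -, hϖ₁, -⟩ := Dm₁.exists_rat_mul_realPeriodRat_eq_plusPeriod
  obtain ⟨ϖ₂, -, hϖ₂, -⟩ := Dm₂.exists_rat_mul_realPeriodRat_eq_plusPeriod
  obtain ⟨ϖ₃, -, hϖ₃, -⟩ := Dm₃.exists_rat_mul_realPeriodRat_eq_plusPeriod
  set D₁ : W₁.SelmerDualData κ γ := W₁.selmerDualData κ hγ with hD₁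
  set D₂ : W₂.SelmerDualData κ γ := W₂.selmerDualData κ hγ with hD₂
  set D₃ : W₃.SelmerDualData κ γ := W₃.selmerDualData κ hγ with hD₃
  obtain ⟨L₁, hL₁⟩ := X11a.exists_isTheMultPAdicLFunctionOf W₁ Dm₁.f p Dm₁.isNewformOf hm₁
  obtain ⟨L₂, hL₂⟩ := X11a.exists_isTheMultPAdicLFunctionOf W₂ Dm₂.f p Dm₂.isNewformOf hm₂
  obtain ⟨L₃, hL₃⟩ := X11a.exists_isTheMultPAdicLFunctionOf W₃ Dm₃.f p Dm₃.isNewformOf hm₃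
  obtain ⟨G, hιG, hG⟩ := H W₁ W₂ W₃ ⟨C₁, hC₁⟩ ⟨C₂, hC₂⟩ ⟨C₃, hC₃⟩ Dm₁.f Dm₂.f Dm₃.f
    Dm₁.isNewformOf Dm₂.isNewformOf Dm₃.isNewformOf D D₁ D₂ D₃ ϖ ϖ₁ ϖ₂ ϖ₃ hϖ hϖ₁ hϖ₂ hϖ₃
    L L₁ L₂ L₃ hL hL₁ hL₂ hL₃
  -- the three twists as auxiliary factors
  let A₁ : X11a.AuxFactorAt p κ γ :=
    { curve := W₁, mult := hm₁, surj := hs₁, level := conductorNorm ℤ W₁, form := Dm₁.f,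
      isNewformOf := Dm₁.isNewformOf, dual := D₁, ϖ := ϖ₁, period := hϖ₁, L := L₁,
      isL := hL₁ }
  let A₂ : X11a.AuxFactorAt p κ γ :=
    { curve := W₂, mult := hm₂, surj := hs₂, level := conductorNorm ℤ W₂, form := Dm₂.f,
      isNewformOf := Dm₂.isNewformOf, dual := D₂, ϖ := ϖ₂, period := hϖ₂, L := L₂,
      isL := hL₂ }
  let A₃ : X11a.AuxFactorAt p κ γ :=
    { curve := W₃, mult := hm₃, surj := hs₃, level := conductorNorm ℤ W₃, form := Dm₃.f,
      isNewformOf := Dm₃.isNewformOf, dual := D₃, ϖ := ϖ₃, period := hϖ₃, L := L₃,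
      isL := hL₃ }
  refine ⟨3, ![A₁, A₂, A₃], G, ?_, ?_⟩
  · have e1 : (∏ i, ((![A₁, A₂, A₃] : Fin 3 → X11a.AuxFactorAt p κ γ) i).ϖ) = ϖ₁ * ϖ₂ * ϖ₃ := by
      rw [Fin.prod_univ_three]; rfl
    have e2 : (∏ i, ((![A₁, A₂, A₃] : Fin 3 → X11a.AuxFactorAt p κ γ) i).L) = L₁ * L₂ * L₃ := by
      rw [Fin.prod_univ_three]; rfl
    rw [hιG, e1, e2]
    simp only [mul_assoc]
  · have e3 : (∏ i, X11a.trivialZeroFactor ((![A₁, A₂, A₃] : Fin 3 → X11a.AuxFactorAt p κ γ) i).curve p) =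
        X11a.trivialZeroFactor W₁ p * X11a.trivialZeroFactor W₂ p * X11a.trivialZeroFactor W₃ p := by
      rw [Fin.prod_univ_three]; rfl
    have e4 : (∏ i, ((![A₁, A₂, A₃] : Fin 3 → X11a.AuxFactorAt p κ γ) i).dual.charIdeal) =
        D₁.charIdeal * D₂.charIdeal * D₃.charIdeal := by
      rw [Fin.prod_univ_three]; rfl
    rw [e3, e4]
    have key : Ideal.span {X11a.trivialZeroFactor W p *
          (X11a.trivialZeroFactor W₁ p * X11a.trivialZeroFactor W₂ p * X11a.trivialZeroFactor W₃ p)} *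
        (D.charIdeal * (D₁.charIdeal * D₂.charIdeal * D₃.charIdeal)) =
        Ideal.span {X11a.trivialZeroFactor W p * X11a.trivialZeroFactor W₁ p *
          X11a.trivialZeroFactor W₂ p * X11a.trivialZeroFactor W₃ p} *
        (D.charIdeal * D₁.charIdeal * D₂.charIdeal * D₃.charIdeal) := by
      simp only [mul_assoc]
    rw [key]
    exact hG

/-! ### By-name bridges to crux 19064 on the surjective sub-leaf -/

/-- **Road p1, product-display socket, on the surjective sub-leaf of crux 19064 (by name)**: the
cyclotomic product display at every X11a pair with `p ≥ 5` and `ρ̄_{E,p}` onto gives the lower half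
`ord_p #Ш_an ≤ ord_p #Ш` there (`X11a.missingLowerBoundAt_of_productDisplay`). PUBLISHED facts: A32
`hKato`, Stein–Wuthrich Thm. 6.1 ×2, Greenberg–Stevens, GZK, modularity `hNf`.
[cite: BurungaleCastellaSkinner2025, display (5.3) (arXiv:2405.00270v2 p. 10) (shape only)]
[cite: Wuthrich2014, Thm. 3 and Cor. 19] [cite: SteinWuthrich2013, Thm. 6.1 (p. 20)] [cite: Miller2011LMS, Def. 1.1] -/
theorem x11aLowerHalf_onSurjFive_of_forall_productDisplayAt (hNf : exists_isNewformOf)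
    (hKato : kato_charIdeal_dvd_multiplicative_of_surjective)
    (hJs : thm61_splitMultiplicative) (hJn : thm61_nonsplitMultiplicative)
    (hGZK : rank_eq_analyticRank_of_analyticRank_le_one)
    (hGS : ∀ (W : WeierstrassCurve ℚ) [W.IsElliptic] [W.IsGloballyMinimal] (p : ℕ) [Fact p.Prime],
      greenberg_stevens (W := W) (p := p))
    (hPD : ∀ (W : WeierstrassCurve ℚ) [W.IsElliptic] [W.IsGloballyMinimal] (p : ℕ) [Fact p.Prime],
      ClassX11a W p → 5 ≤ p → Surj W p → X11a.ProductDisplayAt W p) :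
    ∀ (W : WeierstrassCurve ℚ) [W.IsElliptic] [W.IsGloballyMinimal] (p : ℕ) [Fact p.Prime],
      ClassX11a W p → 5 ≤ p → Surj W p → MissingLowerBoundAt W p :=
  fun W _ _ p _ hX hp hs =>
    X11a.missingLowerBoundAt_of_productDisplay W p hNf hKato hJs hJn hGZK (hGS W p) hX hp hs
      (hPD W p hX hp hs)

/-- **The same with the input asked only on the LEAF** (`X11a.Leaf W p ∧ Surj W p`, i.e. `p ≥ 5`,
`ρ̄` onto and `p ∣ #Ш_an`): on the unit cells `X11a.CellPub` the lower half is PRINTED (Wuthrich 2014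
Prop. 21 `hWu`, GZK, modularity: `X11a.CellPub.bsdp`), so the display is consumed exactly where
something is missing. [cite: Wuthrich2014, Prop. 21 (p. 400)]
[cite: BurungaleCastellaSkinner2025, display (5.3) (arXiv:2405.00270v2 p. 10) (shape only)] [cite: Miller2011LMS, Def. 1.1] -/
theorem x11aLowerHalf_onSurjFive_of_forall_leaf_productDisplayAt (hNf : exists_isNewformOf)
    (hWu : sha_dvd_analyticSha)
    (hKato : kato_charIdeal_dvd_multiplicative_of_surjective)
    (hJs : thm61_splitMultiplicative) (hJn : thm61_nonsplitMultiplicative)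
    (hGZK : rank_eq_analyticRank_of_analyticRank_le_one)
    (hGS : ∀ (W : WeierstrassCurve ℚ) [W.IsElliptic] [W.IsGloballyMinimal] (p : ℕ) [Fact p.Prime],
      greenberg_stevens (W := W) (p := p))
    (hPD : ∀ (W : WeierstrassCurve ℚ) [W.IsElliptic] [W.IsGloballyMinimal] (p : ℕ) [Fact p.Prime],
      X11a.Leaf W p → Surj W p → X11a.ProductDisplayAt W p) :
    ∀ (W : WeierstrassCurve ℚ) [W.IsElliptic] [W.IsGloballyMinimal] (p : ℕ) [Fact p.Prime],
      ClassX11a W p → 5 ≤ p → Surj W p → MissingLowerBoundAt W p := by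
  intro W _ _ p _ hX hp hs
  haveI : Finite W.sha := (hGZK W (by rw [hX.analyticRank_eq_zero]; exact zero_le_one)).2
  refine (lower_and_upper_of_missingPPartAt W p (missingPPartAt_of_bsdp W p ?_)).1
  by_cases hu : X11a.ShaAnUnit W p
  · exact X11a.CellPub.bsdp hWu hGZK (hasEntireLFunction_rat_of_exists_isNewformOf hNf)
      ⟨hX, hp, hs, hu⟩
  · have hL : X11a.Leaf W p := ⟨hX, hp, fun h => hu h.2⟩
    exact X11a.bsdp_of_productDisplay W p hNf hKato hJs hJn hGZK (hGS W p) hX hp hs (hPD W p hL hs)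

/-- **The statement of crux `X11aLowerHalf` (verbatim body) from road p1's PRODUCT-DISPLAY input on
the surjective leaf** plus the two other sub-leaf statements (`p = 3`; `p ≥ 5`, `ρ̄` not onto),
granted the PUBLISHED Wuthrich Prop. 21, A32, Stein–Wuthrich ×2, Greenberg–Stevens, GZK, modularity
(`x11aLowerHalf_of_subleaves`). [cite: BurungaleCastellaSkinner2025, display (5.3) (arXiv:2405.00270v2 p. 10) (shape only)]
[cite: Wuthrich2014, Prop. 21, Thm. 3 and Cor. 19] [cite: Miller2011LMS, Def. 1.1] -/
theorem x11aLowerHalf_of_forall_leaf_productDisplayAt_of_three_of_nonSurj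
    (hNf : exists_isNewformOf) (hWu : sha_dvd_analyticSha)
    (hKato : kato_charIdeal_dvd_multiplicative_of_surjective)
    (hJs : thm61_splitMultiplicative) (hJn : thm61_nonsplitMultiplicative)
    (hGZK : rank_eq_analyticRank_of_analyticRank_le_one)
    (hGS : ∀ (W : WeierstrassCurve ℚ) [W.IsElliptic] [W.IsGloballyMinimal] (p : ℕ) [Fact p.Prime],
      greenberg_stevens (W := W) (p := p))
    (hPD : ∀ (W : WeierstrassCurve ℚ) [W.IsElliptic] [W.IsGloballyMinimal] (p : ℕ) [Fact p.Prime],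
      X11a.Leaf W p → Surj W p → X11a.ProductDisplayAt W p)
    (h3 : ∀ (W : WeierstrassCurve ℚ) [W.IsElliptic] [W.IsGloballyMinimal] (p : ℕ) [Fact p.Prime],
      ClassX11a W p → p = 3 → MissingLowerBoundAt W p)
    (h5n : ∀ (W : WeierstrassCurve ℚ) [W.IsElliptic] [W.IsGloballyMinimal] (p : ℕ) [Fact p.Prime],
      ClassX11a W p → 5 ≤ p → ¬ Surj W p → MissingLowerBoundAt W p) :
    ∀ (Wd : WeierstrassCurve ℚ) [Wd.IsElliptic] [Wd.IsGloballyMinimal] (p : ℕ) [Fact p.Prime],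
      ClassX11a Wd p → MissingLowerBoundAt Wd p :=
  x11aLowerHalf_of_subleaves
    (x11aLowerHalf_onSurjFive_of_forall_leaf_productDisplayAt hNf hWu hKato hJs hJn hGZK hGS hPD)
    h3 h5n

/-- **Road p1's two earlier sockets FACTOR through the product display on the leaf** (S1, `n = 0`):
an Eisenstein half at every leaf pair with onto `ρ̄` is a product display there. Pure logic.
[cite: Skinner2016PacificMC, §3.1–3.3 (shape)] -/
theorem forall_leaf_productDisplayAt_of_forall_leaf_eisensteinHalfAt
    (hE : ∀ (W : WeierstrassCurve ℚ) [W.IsElliptic] [W.IsGloballyMinimal] (p : ℕ) [Fact p.Prime],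
      X11a.Leaf W p → Surj W p → X11a.EisensteinHalfAt W p) :
    ∀ (W : WeierstrassCurve ℚ) [W.IsElliptic] [W.IsGloballyMinimal] (p : ℕ) [Fact p.Prime],
      X11a.Leaf W p → Surj W p → X11a.ProductDisplayAt W p :=
  fun W _ _ p _ hL hs => X11a.productDisplayAt_of_eisensteinHalfAt W p (hE W p hL hs)

/-- **Road p1's two earlier sockets FACTOR through the product display on the leaf** (S2, `n = 3`):
a Burungale–Castella–Skinner four-factor display at every leaf pair with onto `ρ̄` is a product
display there, granted modularity (`hNf`, to attach newforms and `ϖᵢ` to the twists).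
[cite: BurungaleCastellaSkinner2025, Lemma 5.2.3 and display (5.3) (arXiv:2405.00270v2 pp. 9–10) (shape only)] -/
theorem forall_leaf_productDisplayAt_of_forall_leaf_baseChangeLowerBoundAt (hNf : exists_isNewformOf)
    (hBC : ∀ (W : WeierstrassCurve ℚ) [W.IsElliptic] [W.IsGloballyMinimal] (p : ℕ) [Fact p.Prime],
      X11a.Leaf W p → Surj W p → X11a.BaseChangeLowerBoundAt W p) :
    ∀ (W : WeierstrassCurve ℚ) [W.IsElliptic] [W.IsGloballyMinimal] (p : ℕ) [Fact p.Prime],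
      X11a.Leaf W p → Surj W p → X11a.ProductDisplayAt W p :=
  fun W _ _ p _ hL hs =>
    productDisplayAt_of_baseChangeLowerBoundAt W p
      (nonempty_modularParametrizationData_of_exists_isNewformOf hNf
        IsNewformOf.exists_maninConstant_ne_zero_holds)
      hL.five_le hL.classX11a.mult hs (hBC W p hL hs)

end Summit.BirchSwinnertonDyer.BirchSwinnertonDyer.Theorems

end
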